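import Literature.Analysis.FluidPDE.LThetaPressureSliceBounds
import Literature.Analysis.FluidPDE.SerrinEnstrophyGronwall
import Literature.Analysis.FluidPDE.LThetaEnergyBalance
import HarnessLib

/-!
# The `L^θ` slice inequality with the pressure gradient in `L^{(θ+2)/3}` (Lemarié-Rieusset, Prop. 11.7, case `q ≥ 3`)

Analysis/FluidPDE proof file (theorems only: no definition, no named fact, no `sorry`).
Search for candidate a priori estimates; no regularity claim. The analytic core of the case
`q ≥ 3` of the pressure regularity criterion `Literature.Analysis.FluidPDE.pressureGradientCriterion`
(Berselli–Galdi 2002 / Zhou, as in Lemarié-Rieusset 2016, §11.5 Prop. 11.7, PDF pp. 365–366),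
the twin of `Literature.Analysis.FluidPDE.lfour_slice_le_of_momentum` (`LFourPressureSliceEstimate`,
case `1 < q < 3`): for one slice `v = u(t)` of a classical solution with pressure `q = ϖ` and
`θ ≥ 4` (LR: `θ = 3q - 2`, i.e. `q = (θ+2)/3`),
`d/dt ∫|u|^θ = ∫ θ|u|^{θ-2}⟪u, ∂ₜu⟫ ≤ C ν^{-(1-Θ)/Θ} (…‖∇ϖ‖_{L^q}…)^{1/(2Θ)} ∫|u|^θ`,
`Θ = 3(θ-1)/(4(θ+2))`, `1/(2Θ) = 2(θ+2)/(3(θ-1)) = p` with `2/p + 3/q = 3`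
(`ltheta_slice_le_of_momentum`). Ingredients (all PROVED in the tree): the slice identity
`integral_norm_rpow_inner_eq_of_momentum` (`LThetaEnergyIdentities`), the pressure bounds
(11.55)/(11.56), the Sobolev step for `|v|^{θ/2}` and the geometric-mean algebra
(`LThetaPressureSliceBounds`), Lebesgue interpolation (`lintegral_rpow_interpolate`) and Young
absorption (`mul_rpow_mul_rpow_le_absorb`, `SerrinEnstrophyGronwall`). The Calderón–Zygmund bound
`‖ϖ‖_{(θ+2)/2} ≤ C_S‖v‖²_{θ+2}` enters as a hypothesis (Stein; `NormalisedPressureLpClass` for the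
normalised pressure). The Grönwall step on a Tao slab is `ltheta_energy_le_mul_exp` (twin of
`lfour_energy_le_mul_exp`): `∫|u(s)|^θ ≤ exp(κ ∫₀ˢ a(t)^{1/Θ}dt) ∫|u(0)|^θ`. The assembly of the
criterion for `q ≥ 3` is not in this file.

## References

* [LemarieRieusset2016] P. G. Lemarié-Rieusset, *The Navier–Stokes problem in the 21st century*,
  CRC Press 2016 — §11.5 Prop. 11.7 proof, (11.55)–(11.57) (PDF pp. 365–366).
* [BerselliGaldi2002] L. C. Berselli, G. P. Galdi, Proc. AMS 130 (2002) 3585–3595 — Thm. 3.3.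
-/

noncomputable section

open MeasureTheory Set Function Filter Topology InnerProductSpace
open scoped ENNReal NNReal ContDiff RealInnerProductSpace Laplacian

namespace Literature.Analysis.FluidPDE

/-! ### The `L^θ` slice inequality, `θ ≥ 4` (`q = (θ+2)/3 ≥ 2`; LR's case `q ≥ 3` is `θ ≥ 7`) -/

section Slice

/-- **The `L^θ` slice inequality (Lemarié-Rieusset 2016, Prop. 11.7, case `q ≥ 3`,
(11.55)–(11.57)).** Let `v : ℝ³ → ℝ³` be `C²`, bounded, divergence free, with `v, Dv, D²v ∈ L²`,
`q : ℝ³ → ℝ` a `C¹` scalar with `q, Dq ∈ L²`, and `W` a field with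
`W + (v·∇)v = νΔv - ∇q` pointwise (`ν > 0`). Let `θ ≥ 4`, `Q = (θ+2)/3`, assume `∇q ∈ L^Q` and
the Calderón–Zygmund bound `‖q‖_{(θ+2)/2} ≤ C_S‖v‖²_{θ+2}` (Stein; a HYPOTHESIS), and put
`Θ = 3(θ-1)/(4(θ+2)) ∈ (0, 1)`. Then
`∫ θ‖v‖^{θ-2}⟪v, W⟫ ≤ Θ(2(1-Θ))^{(1-Θ)/Θ} (νθ(θ-2))^{-(1-Θ)/Θ} a^{1/Θ} ∫‖v‖^θ`,
`a = θ √((θ-2) C_S ‖∇q‖_{L^Q}) (K²θ²/4)^{9/(4(θ+2))}` (`K` the Sobolev constant) — so the weight is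
`‖∇q‖_{L^Q}^{1/(2Θ)}`, `1/(2Θ) = 2(θ+2)/(3(θ-1)) = p` with `2/p + 3/Q = 3`. For a classical
Navier–Stokes solution (`W = ∂ₜu`) the left side is `d/dt ∫|u|^θ`. Proof: the slice identity
(`integral_norm_rpow_inner_eq_of_momentum`), the two pressure bounds (11.55)/(11.56)
(`abs_integral_inner_gradient_norm_rpow_smul_le`, `abs_integral_mul_norm_rpow_inner_convect_le` with
`integral_sq_mul_norm_rpow_le_of_eLpNorm_le`), Lebesgue interpolation `θ < θ+2 < 3θ` with the
Sobolev bound `lintegral_norm_rpow_three_mul_le`, the geometric mean `gm_interpolation_bound`, and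
Young absorption into the dissipation `νθ(θ-2)∫‖v‖^{θ-4}Σᵢ⟪v,∂ᵢv⟫²`.
[cite: LemarieRieusset2016, §11.5 Prop. 11.7 proof, (11.55)–(11.57) (PDF pp. 365–366)] -/
theorem ltheta_slice_le_of_momentum {ν : ℝ} (hν : 0 < ν)
    {v W : EuclideanSpace ℝ (Fin 3) → EuclideanSpace ℝ (Fin 3)} {q : EuclideanSpace ℝ (Fin 3) → ℝ}
    (hv : ContDiff ℝ 2 v) (hq : ContDiff ℝ 1 q)
    (hmom : ∀ x, W x + FluidPDE.convect v v x = ν • (Δ v) x - gradient q x)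
    (hdiv : VectorCalculus.IsDivFree v) {B : ℝ} (hB : ∀ x, ‖v x‖ ≤ B)
    (hv0 : ∫⁻ x, ‖v x‖ₑ ^ 2 < ⊤) (hv1 : ∫⁻ x, ‖iteratedFDeriv ℝ 1 v x‖ₑ ^ 2 < ⊤)
    (hv2 : ∫⁻ x, ‖iteratedFDeriv ℝ 2 v x‖ₑ ^ 2 < ⊤)
    (hq0 : ∫⁻ x, ‖q x‖ₑ ^ 2 < ⊤) (hq1 : ∫⁻ x, ‖iteratedFDeriv ℝ 1 q x‖ₑ ^ 2 < ⊤)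
    {θ : ℝ} (hθ : 4 ≤ θ)
    (hqQ : eLpNorm (fun x => gradient q x) (ENNReal.ofReal ((θ + 2) / 3)) volume < ⊤)
    {CS : ℝ≥0}
    (hRz : eLpNorm q (ENNReal.ofReal ((θ + 2) / 2)) volume ≤
      CS * eLpNorm v (ENNReal.ofReal (θ + 2)) volume ^ 2)
    {Θ : ℝ} (hΘ : Θ = 3 * (θ - 1) / (4 * (θ + 2))) :
    ∫ x, θ * ‖v x‖ ^ (θ - 2) * ⟪v x, W x⟫ ≤
      Θ * (2 * (1 - Θ)) ^ ((1 - Θ) / Θ) * (ν * θ * (θ - 2)) ^ (-((1 - Θ) / Θ)) *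
        (θ * Real.sqrt ((θ - 2) * CS *
            (∫ x, ‖gradient q x‖ ^ ((θ + 2) / 3)) ^ (1 / ((θ + 2) / 3))) *
          ((SNormLESNormFDerivOfEqConst ℝ (volume : Measure (EuclideanSpace ℝ (Fin 3))) 2 : ℝ) ^ 2 *
              (θ ^ 2 / 4)) ^ (9 / (4 * (θ + 2)))) ^ (1 / Θ) *
        ∫ x, ‖v x‖ ^ θ := by
  set e := EuclideanSpace.basisFun (Fin 3) ℝ with he
  set K : ℝ≥0 := SNormLESNormFDerivOfEqConst ℝ (volume : Measure (EuclideanSpace ℝ (Fin 3))) 2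
    with hK
  set Q : ℝ := (θ + 2) / 3 with hQ
  set N : ℝ := (∫ x, ‖gradient q x‖ ^ Q) ^ (1 / Q) with hNdef
  have hN0 : 0 ≤ N := Real.rpow_nonneg (integral_nonneg fun x => Real.rpow_nonneg (norm_nonneg _) _) _
  have hB0 : 0 ≤ B := (norm_nonneg _).trans (hB 0)
  have hv1' : ContDiff ℝ 1 v := hv.of_le (by norm_num)
  have hθ0 : 0 < θ := by linarith
  have hθ2 : 0 < θ - 2 := by linarith
  have hθp2 : 0 < θ + 2 := by linarith
  have hQ1 : 1 < Q := by rw [hQ]; linarith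
  have hΘ0 : 0 < Θ := by rw [hΘ]; exact div_pos (by linarith) (by linarith)
  have hΘ1 : Θ < 1 := by rw [hΘ, div_lt_one (by linarith)]; linarith
  -- the real quantities
  have cv : Continuous v := hv.continuous
  have cdv : ∀ i, Continuous fun x => fderiv ℝ v x (e i) := fun i =>
    (hv.continuous_fderiv (by norm_num)).clm_apply continuous_const
  have n_dv : ∀ i x, ‖fderiv ℝ v x (e i)‖ ≤ ‖iteratedFDeriv ℝ 1 v x‖ := fun i x =>
    norm_fderiv_apply_basisFun_le v x i
  have crp : ∀ {c : ℝ}, 0 ≤ c → Continuous fun x => ‖v x‖ ^ c := fun hc =>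
    cv.norm.rpow_const fun _ => Or.inr hc
  have hrp_le : ∀ {c : ℝ}, 0 ≤ c → ∀ x, ‖v x‖ ^ c ≤ B ^ c := fun hc x =>
    Real.rpow_le_rpow (norm_nonneg _) (hB x) hc
  set G : EuclideanSpace ℝ (Fin 3) → ℝ := fun x => ∑ i, ⟪v x, fderiv ℝ v x (e i)⟫ ^ 2 with hG
  have hG0 : ∀ x, 0 ≤ G x := fun x => Finset.sum_nonneg fun i _ => sq_nonneg _
  have cG : Continuous G := continuous_finsetSum _ fun i _ => (cv.inner (cdv i)).pow 2
  have i_d1 : Integrable (fun x => ‖iteratedFDeriv ℝ 1 v x‖ ^ 2) volume :=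
    FluidPDE.integrable_sq_norm_of_lintegral_lt_top (hv.continuous_iteratedFDeriv (by norm_num)) hv1
  have i_G : Integrable G volume := by
    have hdom : Integrable (fun x => 3 * (B ^ 2 * ‖iteratedFDeriv ℝ 1 v x‖ ^ 2)) volume :=
      (i_d1.const_mul _).const_mul _
    refine hdom.mono' cG.aestronglyMeasurable (Eventually.of_forall fun x => ?_)
    rw [Real.norm_of_nonneg (hG0 x), hG]
    dsimp only
    have hterm : ∀ i, ⟪v x, fderiv ℝ v x (e i)⟫ ^ 2 ≤ B ^ 2 * ‖iteratedFDeriv ℝ 1 v x‖ ^ 2 := by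
      intro i
      rw [← mul_pow]
      have h := abs_real_inner_le_norm (v x) (fderiv ℝ v x (e i))
      calc ⟪v x, fderiv ℝ v x (e i)⟫ ^ 2 = |⟪v x, fderiv ℝ v x (e i)⟫| ^ 2 := (sq_abs _).symm
        _ ≤ (‖v x‖ * ‖fderiv ℝ v x (e i)‖) ^ 2 := pow_le_pow_left₀ (abs_nonneg _) h 2
        _ ≤ (B * ‖iteratedFDeriv ℝ 1 v x‖) ^ 2 :=
            pow_le_pow_left₀ (by positivity)
              (mul_le_mul (hB x) (n_dv i x) (norm_nonneg _) hB0) 2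
    calc ∑ i, ⟪v x, fderiv ℝ v x (e i)⟫ ^ 2 ≤ ∑ _i : Fin 3, B ^ 2 * ‖iteratedFDeriv ℝ 1 v x‖ ^ 2 :=
          Finset.sum_le_sum fun i _ => hterm i
      _ = 3 * (B ^ 2 * ‖iteratedFDeriv ℝ 1 v x‖ ^ 2) := by simp
  have i_WG : Integrable (fun x => ‖v x‖ ^ (θ - 4) * G x) volume := by
    refine (i_G.const_mul (B ^ (θ - 4))).mono' ((crp (by linarith)).mul cG).aestronglyMeasurable
      (Eventually.of_forall fun x => ?_)
    rw [Real.norm_of_nonneg (mul_nonneg (Real.rpow_nonneg (norm_nonneg _) _) (hG0 x))]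
    exact mul_le_mul_of_nonneg_right (hrp_le (by linarith) x) (hG0 x)
  -- the weighted Frobenius term is integrable and nonnegative
  set Fr : EuclideanSpace ℝ (Fin 3) → ℝ :=
    fun x => ‖v x‖ ^ (θ - 2) * FluidPDE.frobeniusNormSq (fderiv ℝ v x) with hFr
  have hFr0 : ∀ x, 0 ≤ Fr x := fun x =>
    mul_nonneg (Real.rpow_nonneg (norm_nonneg _) _) (FluidPDE.frobeniusNormSq_nonneg _)
  have cFr : Continuous Fr :=
    (crp (by linarith)).mul (FluidPDE.continuous_frobeniusNormSq_fderiv hv (by simp))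
  have i_Fr : Integrable Fr volume := by
    have hdom : Integrable (fun x => B ^ (θ - 2) * (3 * ‖iteratedFDeriv ℝ 1 v x‖ ^ 2)) volume :=
      (i_d1.const_mul _).const_mul _
    refine hdom.mono' cFr.aestronglyMeasurable (Eventually.of_forall fun x => ?_)
    rw [Real.norm_of_nonneg (hFr0 x), hFr]
    dsimp only
    have h2 : FluidPDE.frobeniusNormSq (fderiv ℝ v x) ≤ 3 * ‖iteratedFDeriv ℝ 1 v x‖ ^ 2 := by
      have hn : ‖fderiv ℝ v x‖ = ‖iteratedFDeriv ℝ 1 v x‖ := by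
        rw [← norm_iteratedFDeriv_fderiv, norm_iteratedFDeriv_zero]
      have h := frobeniusNormSq_le_three_mul (fderiv ℝ v x)
      rwa [hn] at h
    exact mul_le_mul (hrp_le (by linarith) x) h2 (FluidPDE.frobeniusNormSq_nonneg _)
      (Real.rpow_nonneg hB0 _)
  -- integrability of the powers `‖v‖^θ`, `‖v‖^{θ+2}`
  have i_v2 : Integrable (fun x => ‖v x‖ ^ 2) volume :=
    FluidPDE.integrable_sq_norm_of_lintegral_lt_top cv hv0
  have i_pow : ∀ {c : ℝ}, 2 ≤ c → Integrable (fun x => ‖v x‖ ^ c) volume := by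
    intro c hc
    have hdom : Integrable (fun x => B ^ (c - 2) * ‖v x‖ ^ 2) volume := i_v2.const_mul _
    refine hdom.mono' (crp (by linarith)).aestronglyMeasurable (Eventually.of_forall fun x => ?_)
    rw [Real.norm_of_nonneg (Real.rpow_nonneg (norm_nonneg _) _)]
    have hsplit : ‖v x‖ ^ c = ‖v x‖ ^ (c - 2) * ‖v x‖ ^ 2 := by
      rw [← Real.rpow_natCast (‖v x‖) 2, ← Real.rpow_add' (norm_nonneg _) (by norm_num; linarith)]
      norm_num
    rw [hsplit]
    exact mul_le_mul_of_nonneg_right (hrp_le (by linarith) x) (sq_nonneg _)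
  have hconv : ∀ {c : ℝ}, 2 ≤ c → ENNReal.ofReal (∫ x, ‖v x‖ ^ c) = ∫⁻ x, ‖v x‖ₑ ^ c := by
    intro c hc
    rw [ofReal_integral_eq_lintegral_ofReal (i_pow hc)
      (Eventually.of_forall fun x => Real.rpow_nonneg (norm_nonneg _) _)]
    refine lintegral_congr fun x => ?_
    rw [← ofReal_norm, ENNReal.ofReal_rpow_of_nonneg (norm_nonneg _) (by linarith)]
  set E : ℝ := ∫ x, ‖v x‖ ^ θ with hE
  set M : ℝ := ∫ x, ‖v x‖ ^ (θ + 2) with hM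
  set D : ℝ := ∫ x, ‖v x‖ ^ (θ - 4) * G x with hD
  set Jraw : ℝ := ∫ x, q x * (‖v x‖ ^ (θ - 4) * ⟪v x, FluidPDE.convect v v x⟫) with hJraw
  have hE0 : 0 ≤ E := integral_nonneg fun x => Real.rpow_nonneg (norm_nonneg _) _
  have hM0 : 0 ≤ M := integral_nonneg fun x => Real.rpow_nonneg (norm_nonneg _) _
  have hD0 : 0 ≤ D := integral_nonneg fun x => mul_nonneg (Real.rpow_nonneg (norm_nonneg _) _) (hG0 x)
  have hIFr0 : 0 ≤ ∫ x, Fr x := integral_nonneg hFr0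
  -- Step 1: the identity and the dissipation split
  have hI := integral_norm_rpow_inner_eq_of_momentum hv hq hmom hdiv hB hθ hv0 hv1 hv2 hq0 hq1
  have hsplit : ∫ x, (‖v x‖ ^ (θ - 2) * FluidPDE.frobeniusNormSq (fderiv ℝ v x) +
      (θ - 2) * ‖v x‖ ^ (θ - 4) * ∑ i, ⟪v x, fderiv ℝ v x (e i)⟫ ^ 2) =
      (∫ x, Fr x) + (θ - 2) * D := by
    rw [hD, ← integral_const_mul, ← integral_add i_Fr (i_WG.const_mul _)]
    refine integral_congr_ae (Eventually.of_forall fun x => ?_)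
    simp only [hFr, hG, mul_assoc]
  -- Step 2: the two pressure bounds on `X = θ |∫⟪∇q, ‖v‖^{θ-2}v⟫|`
  have hI3 := integral_inner_gradient_norm_rpow_smul hq hv1' hdiv hθ hB hv0 hv1 hq0 hq1
  set X : ℝ := θ * |∫ x, ⟪gradient q x, ‖v x‖ ^ (θ - 2) • v x⟫| with hX
  have hX0 : 0 ≤ X := mul_nonneg hθ0.le (abs_nonneg _)
  have hJX : θ * (θ - 2) * Jraw ≤ X := by
    have h1 : θ * (θ - 2) * Jraw = -(θ * ∫ x, ⟪gradient q x, ‖v x‖ ^ (θ - 2) • v x⟫) := by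
      rw [hI3, hJraw]; ring
    rw [h1, hX]
    have := neg_abs_le (∫ x, ⟪gradient q x, ‖v x‖ ^ (θ - 2) • v x⟫)
    nlinarith [abs_nonneg (∫ x, ⟪gradient q x, ‖v x‖ ^ (θ - 2) • v x⟫)]
  -- (11.55)
  have b1 : X ≤ θ * N * M ^ ((θ - 1) / (θ + 2)) := by
    have h := abs_integral_inner_gradient_norm_rpow_smul_le cv hB hv0 hq hQ1 hqQ hθ
    have hθ1 : θ - 1 ≠ 0 := ne_of_gt (by linarith)
    have hQm1 : Q / (Q - 1) = (θ + 2) / (θ - 1) := by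
      have h1 : Q - 1 = (θ - 1) / 3 := by rw [hQ]; ring
      rw [h1, hQ, div_div_div_cancel_right₀ three_ne_zero]
    have hexp : (θ - 1) * (Q / (Q - 1)) = θ + 2 := by
      rw [hQm1]; field_simp
    have hexp' : 1 / (Q / (Q - 1)) = (θ - 1) / (θ + 2) := by
      rw [hQm1, one_div_div]
    rw [hexp, hexp'] at h
    rw [hX, mul_assoc]
    exact mul_le_mul_of_nonneg_left h hθ0.le
  -- (11.56)
  have b2 : X ≤ θ * (θ - 2) * CS * M ^ (1 / 2 : ℝ) * D ^ (1 / 2 : ℝ) := by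
    have hCSb := abs_integral_mul_norm_rpow_inner_convect_le hv1' hB hv1 hq.continuous hq0 hθ
    have hP := integral_sq_mul_norm_rpow_le_of_eLpNorm_le cv hB hv0 hq.continuous hq0 hθ hRz
    have h1 : Real.sqrt (∫ x, q x ^ 2 * ‖v x‖ ^ (θ - 2)) ≤ CS * M ^ (1 / 2 : ℝ) := by
      refine (Real.sqrt_le_sqrt hP).trans (le_of_eq ?_)
      rw [Real.sqrt_mul (sq_nonneg _), Real.sqrt_sq (NNReal.coe_nonneg _), Real.sqrt_eq_rpow]
    have h2 : |Jraw| ≤ CS * M ^ (1 / 2 : ℝ) * D ^ (1 / 2 : ℝ) := by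
      rw [hJraw]
      refine hCSb.trans ?_
      rw [← Real.sqrt_eq_rpow D]
      exact mul_le_mul_of_nonneg_right h1 (Real.sqrt_nonneg _)
    have h3 : X = θ * (θ - 2) * |Jraw| := by
      rw [hX, hI3, abs_neg, abs_mul, abs_of_pos hθ2, hJraw]; ring
    rw [h3]
    calc θ * (θ - 2) * |Jraw| ≤ θ * (θ - 2) * (CS * M ^ (1 / 2 : ℝ) * D ^ (1 / 2 : ℝ)) :=
          mul_le_mul_of_nonneg_left h2 (by positivity)
      _ = θ * (θ - 2) * CS * M ^ (1 / 2 : ℝ) * D ^ (1 / 2 : ℝ) := by ring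
  -- Step 3: interpolation `θ < θ+2 < 3θ` and Sobolev for `|v|^{θ/2}`
  set c : ℝ := (K : ℝ) ^ 2 * (θ ^ 2 / 4) with hc
  have hc0 : 0 ≤ c := by positivity
  have hint : M ≤ E ^ ((θ - 1) / θ) * (c * D) ^ (3 / θ) := by
    have hI' := lintegral_rpow_interpolate (cv.aemeasurable (μ := volume)).enorm (a := θ)
      (b := 3 * θ) (r := θ + 2)
      hθ0 (by linarith) (by linarith) (by linarith)
    have hS := lintegral_norm_rpow_three_mul_le hv1' hB hv0 hv1 hθ
    have hα : (3 * θ - (θ + 2)) / (3 * θ - θ) = (θ - 1) / θ := by field_simp; ring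
    have hβ : (θ + 2 - θ) / (3 * θ - θ) = 1 / θ := by field_simp; ring
    rw [hα, hβ, ← hconv (by linarith : (2 : ℝ) ≤ θ + 2), ← hconv (by linarith : (2 : ℝ) ≤ θ)] at hI'
    have h3 : (∫⁻ x, ‖v x‖ₑ ^ (3 * θ)) ^ (1 / θ) ≤ ENNReal.ofReal ((c * D) ^ (3 / θ)) := by
      calc (∫⁻ x, ‖v x‖ₑ ^ (3 * θ)) ^ (1 / θ)
          ≤ (((K : ℝ≥0∞) ^ 2 * ENNReal.ofReal (θ ^ 2 / 4 * D)) ^ (3 : ℝ)) ^ (1 / θ) :=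
            ENNReal.rpow_le_rpow hS (by positivity)
        _ = ENNReal.ofReal ((c * D) ^ (3 / θ)) := by
            rw [← ENNReal.rpow_mul, hc]
            have hKc : (K : ℝ≥0∞) ^ 2 * ENNReal.ofReal (θ ^ 2 / 4 * D) =
                ENNReal.ofReal ((K : ℝ) ^ 2 * (θ ^ 2 / 4) * D) := by
              rw [mul_assoc, ENNReal.ofReal_mul (sq_nonneg _), ENNReal.ofReal_pow (NNReal.coe_nonneg _),
                ENNReal.ofReal_coe_nnreal]
            rw [hKc, ENNReal.ofReal_rpow_of_nonneg (by positivity) (by positivity)]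
            congr 1; field_simp
    have h4 : ENNReal.ofReal M ≤ ENNReal.ofReal (E ^ ((θ - 1) / θ) * (c * D) ^ (3 / θ)) := by
      refine hI'.trans ?_
      rw [ENNReal.ofReal_mul (Real.rpow_nonneg hE0 _),
        ENNReal.ofReal_rpow_of_nonneg hE0 (div_nonneg (by linarith) hθ0.le)]
      exact mul_le_mul_right h3 _
    exact (ENNReal.ofReal_le_ofReal_iff (by positivity)).1 h4
  -- Step 4: geometric mean and Young
  set a : ℝ := θ * Real.sqrt ((θ - 2) * CS * N) * c ^ (9 / (4 * (θ + 2))) with ha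
  have ha0 : 0 ≤ a := by positivity
  have hgm := gm_interpolation_bound hX0 hN0 hM0 hE0 hD0 (NNReal.coe_nonneg CS) hc0 hθ b1 b2 hint
  rw [← hΘ] at hgm
  have hgm' : X ≤ a * E ^ Θ * D ^ (1 - Θ) := by rw [ha]; exact hgm
  have hνθ : 0 < ν * θ * (θ - 2) := by positivity
  have hYoung := mul_rpow_mul_rpow_le_absorb hΘ0 hΘ1 hνθ ha0 hD0 hE0
  -- Step 5: assemble
  set Cfin : ℝ := Θ * (2 * (1 - Θ)) ^ ((1 - Θ) / Θ) * (ν * θ * (θ - 2)) ^ (-((1 - Θ) / Θ)) *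
    a ^ (1 / Θ) with hCfin
  have h1 : ∫ x, θ * ‖v x‖ ^ (θ - 2) * ⟪v x, W x⟫ =
      -(ν * θ) * ((∫ x, Fr x) + (θ - 2) * D) + θ * (θ - 2) * Jraw := by rw [hI, hsplit]
  have h2 : -(ν * θ) * ((∫ x, Fr x) + (θ - 2) * D) ≤ -(ν * θ * (θ - 2)) * D := by
    have h := mul_nonneg (mul_nonneg hν.le hθ0.le) hIFr0
    linarith
  have h3 : θ * (θ - 2) * Jraw ≤ ν * θ * (θ - 2) / 2 * D + Cfin * E :=
    hJX.trans (hgm'.trans (hYoung.trans_eq (by rw [hCfin])))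
  have h4 : 0 ≤ ν * θ * (θ - 2) * D := mul_nonneg hνθ.le hD0
  rw [h1]
  linarith

end Slice


section Gronwall

/-- **The `L^θ` energy inequality on a Tao slab, `θ ≥ 4` (Lemarié-Rieusset 2016, Prop. 11.7,
case `q ≥ 3`).** Let `(u, p)` be a classical solution of the unforced Navier–Stokes system on
`[0, T] × ℝ³` (`ν > 0`) in Tao's `L²`-Sobolev class (all `L²` Sobolev norms of `u`, `∂ₜu` and `p`
bounded on `[0, T]`). Let `θ ≥ 4`, `Q = (θ+2)/3`, `Θ = 3(θ-1)/(4(θ+2))`, and let `s ∈ (0, T]`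
be such that for a.e. `t ∈ (0, s)` the pressure satisfies `∇p(t) ∈ L^Q` and the Calderón–Zygmund
bound `‖p(t)‖_{(θ+2)/2} ≤ C_S‖u(t)‖²_{θ+2}`, with finite weight
`A = ∫₀ˢ a(t)^{1/Θ} dt`, `a(t) = θ √((θ-2) C_S ‖∇p(t)‖_{L^Q}) (K²θ²/4)^{9/(4(θ+2))}`
(`a(t)^{1/Θ} ∝ ‖∇p(t)‖_{L^Q}^{p}`, `2/p + 3/Q = 3`). Then
`∫|u(s)|^θ ≤ exp(κ A) ∫|u(0)|^θ`, `κ = Θ(2(1-Θ))^{(1-Θ)/Θ} (νθ(θ-2))^{-(1-Θ)/Θ}` — Grönwall on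
`d/dt ∫|u|^θ ≤ κ a(t)^{1/Θ} ∫|u|^θ` (`ltheta_slice_le_of_momentum`, `lTheta_balance`,
`lintegral_gronwall_le`); the twin of `lfour_energy_le_mul_exp`.
[cite: LemarieRieusset2016, §11.5 Prop. 11.7 proof, (11.57) (PDF p. 366)] -/
theorem ltheta_energy_le_mul_exp {ν T : ℝ} (hν : 0 < ν) (hT : 0 < T)
    {u : ℝ → EuclideanSpace ℝ (Fin 3) → EuclideanSpace ℝ (Fin 3)}
    {p : ℝ → EuclideanSpace ℝ (Fin 3) → ℝ} (hsol : FluidPDE.IsClassicalNSSolutionOn (Icc 0 T) ν 0 u p)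
    (hu : HasBoundedSobolevNormsOn (Icc 0 T) u)
    (hut : HasBoundedSobolevNormsOn (Icc 0 T) (FluidPDE.timeDerivWithin (Icc 0 T) u))
    (hp : ∀ n : ℕ, ∃ C : ℝ≥0, ∀ t ∈ Icc 0 T, ∫⁻ x, ‖iteratedFDeriv ℝ n (p t) x‖ₑ ^ 2 ≤ C)
    {θ : ℝ} (hθ : 4 ≤ θ) {Θ : ℝ} (hΘ : Θ = 3 * (θ - 1) / (4 * (θ + 2))) {CS : ℝ≥0} {s : ℝ}
    (hs : s ∈ Ioc 0 T)
    (hLq : ∀ᵐ t ∂volume, t ∈ Ioo 0 s →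
      eLpNorm (fun x => gradient (p t) x) (ENNReal.ofReal ((θ + 2) / 3)) volume < ⊤ ∧
      eLpNorm (p t) (ENNReal.ofReal ((θ + 2) / 2)) volume ≤
        CS * eLpNorm (u t) (ENNReal.ofReal (θ + 2)) volume ^ 2)
    (hA : ∫⁻ t in Ioo 0 s, ENNReal.ofReal
      ((θ * Real.sqrt ((θ - 2) * CS *
          (∫ x, ‖gradient (p t) x‖ ^ ((θ + 2) / 3)) ^ (1 / ((θ + 2) / 3))) *
        ((SNormLESNormFDerivOfEqConst ℝ (volume : Measure (EuclideanSpace ℝ (Fin 3))) 2 : ℝ) ^ 2 *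
            (θ ^ 2 / 4)) ^ (9 / (4 * (θ + 2)))) ^ (1 / Θ)) ≠ ⊤) :
    ∫⁻ x, ENNReal.ofReal (‖u s x‖ ^ θ) ≤
      ENNReal.ofReal (Real.exp
        (Θ * (2 * (1 - Θ)) ^ ((1 - Θ) / Θ) * (ν * θ * (θ - 2)) ^ (-((1 - Θ) / Θ)) *
          (∫⁻ t in Ioo 0 s, ENNReal.ofReal
            ((θ * Real.sqrt ((θ - 2) * CS *
                (∫ x, ‖gradient (p t) x‖ ^ ((θ + 2) / 3)) ^ (1 / ((θ + 2) / 3))) *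
              ((SNormLESNormFDerivOfEqConst ℝ (volume : Measure (EuclideanSpace ℝ (Fin 3))) 2 : ℝ) ^ 2 *
                  (θ ^ 2 / 4)) ^ (9 / (4 * (θ + 2)))) ^ (1 / Θ))).toReal)) *
        ∫⁻ x, ENNReal.ofReal (‖u 0 x‖ ^ θ) := by
  set K : ℝ := (SNormLESNormFDerivOfEqConst ℝ (volume : Measure (EuclideanSpace ℝ (Fin 3))) 2 : ℝ)
    with hK
  have hU : UniqueDiffOn ℝ (Icc 0 T) := uniqueDiffOn_Icc hT
  set W : ℝ → EuclideanSpace ℝ (Fin 3) → EuclideanSpace ℝ (Fin 3) :=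
    FluidPDE.timeDerivWithin (Icc 0 T) u with hW
  -- the exponents
  have hθ0 : 0 < θ := by linarith
  have hθ2 : 0 < θ - 2 := by linarith
  have hΘ0 : 0 < Θ := by rw [hΘ]; exact div_pos (by linarith) (by linarith)
  have hΘ1 : Θ < 1 := by rw [hΘ, div_lt_one (by linarith)]; linarith
  set κ : ℝ := Θ * (2 * (1 - Θ)) ^ ((1 - Θ) / Θ) * (ν * θ * (θ - 2)) ^ (-((1 - Θ) / Θ)) with hκ
  have hκ0 : 0 ≤ κ := by
    have : 0 ≤ 1 - Θ := by linarith
    have : 0 < ν * θ * (θ - 2) := by positivity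
    positivity
  -- pointwise and `L²` bounds on the slab
  obtain ⟨B₀, hB₀⟩ := linfty_bound_of_hasBoundedSobolevNormsOn_holds
    (fun t ht => (hsol.contDiff_velocity ht).of_le (by norm_cast)) hu
  obtain ⟨C₀, hC₀⟩ := hu 0
  obtain ⟨C₁, hC₁⟩ := hu 1
  obtain ⟨D₂, hD₂⟩ := hu 2
  obtain ⟨E₀, hE₀⟩ := hut 0
  obtain ⟨P₀, hP₀⟩ := hp 0
  obtain ⟨P₁, hP₁⟩ := hp 1
  have hzero : ∀ {f : EuclideanSpace ℝ (Fin 3) → EuclideanSpace ℝ (Fin 3)} {C' : ℝ≥0},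
      (∫⁻ x, ‖iteratedFDeriv ℝ 0 f x‖ₑ ^ 2 ≤ C') → ∫⁻ x, ‖f x‖ₑ ^ 2 ≤ C' := by
    intro f C' h
    refine (le_of_eq (lintegral_congr fun x => ?_)).trans h
    rw [← ofReal_norm, ← ofReal_norm, norm_iteratedFDeriv_zero]
  have hzero' : ∀ {f : EuclideanSpace ℝ (Fin 3) → ℝ} {C' : ℝ≥0},
      (∫⁻ x, ‖iteratedFDeriv ℝ 0 f x‖ₑ ^ 2 ≤ C') → ∫⁻ x, ‖f x‖ₑ ^ 2 < ⊤ := by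
    intro f C' h
    refine lt_of_le_of_lt ((le_of_eq (lintegral_congr fun x => ?_)).trans h) ENNReal.coe_lt_top
    rw [← ofReal_norm, ← ofReal_norm, norm_iteratedFDeriv_zero]
  have hB₀0 : 0 ≤ B₀ := (norm_nonneg _).trans (hB₀ 0 ⟨le_rfl, hT.le⟩ 0)
  -- the `L^θ` balance
  obtain ⟨hΦint, -, hGb⟩ := hsol.smooth_velocity.lTheta_balance hT (θ := θ) (by linarith) hB₀
    (fun t ht => hzero (hC₀ t ht)) (fun t ht => hzero (hE₀ t ht))
  set Φ : ℝ → ℝ := fun t => ∫ x, θ * ‖u t x‖ ^ (θ - 2) * ⟪u t x, W t x⟫ with hΦ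
  set G : ℝ → ℝ := fun t => ∫ x, ‖u t x‖ ^ θ with hG
  have hG0 : ∀ t, 0 ≤ G t := fun t => integral_nonneg fun x => Real.rpow_nonneg (norm_nonneg _) _
  -- integrability of `‖u t‖^θ` and the uniform bound `G t ≤ B₀^{θ-2} C₀`
  have i_u2 : ∀ t ∈ Icc 0 T, Integrable (fun x => ‖u t x‖ ^ 2) volume := fun t ht =>
    FluidPDE.integrable_sq_norm_of_lintegral_lt_top (hsol.contDiff_velocity ht).continuous
      ((hzero (hC₀ t ht)).trans_lt ENNReal.coe_lt_top)
  have hptθ : ∀ t ∈ Icc 0 T, ∀ x, ‖u t x‖ ^ θ ≤ B₀ ^ (θ - 2) * ‖u t x‖ ^ 2 := by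
    intro t ht x
    have hsplit : ‖u t x‖ ^ θ = ‖u t x‖ ^ (θ - 2) * ‖u t x‖ ^ 2 := by
      rw [← Real.rpow_natCast (‖u t x‖) 2, ← Real.rpow_add' (norm_nonneg _) (by norm_num; linarith)]
      norm_num
    rw [hsplit]
    exact mul_le_mul_of_nonneg_right
      (Real.rpow_le_rpow (norm_nonneg _) (hB₀ t ht x) hθ2.le) (sq_nonneg _)
  have i_uθ : ∀ t ∈ Icc 0 T, Integrable (fun x => ‖u t x‖ ^ θ) volume := by
    intro t ht
    have hc : Continuous fun x => ‖u t x‖ ^ θ :=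
      (hsol.contDiff_velocity ht).continuous.norm.rpow_const fun _ => Or.inr hθ0.le
    refine ((i_u2 t ht).const_mul (B₀ ^ (θ - 2))).mono' hc.aestronglyMeasurable
      (Eventually.of_forall fun x => ?_)
    rw [Real.norm_of_nonneg (Real.rpow_nonneg (norm_nonneg _) _)]
    exact hptθ t ht x
  have hGeq : ∀ t ∈ Icc 0 T, ENNReal.ofReal (G t) = ∫⁻ x, ENNReal.ofReal (‖u t x‖ ^ θ) :=
    fun t ht => ofReal_integral_eq_lintegral_ofReal (i_uθ t ht)
      (Eventually.of_forall fun x => Real.rpow_nonneg (norm_nonneg _) _)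
  have hGle : ∀ t ∈ Icc 0 T, ENNReal.ofReal (G t) ≤ ENNReal.ofReal (B₀ ^ (θ - 2)) * C₀ := by
    intro t ht
    rw [hGeq t ht]
    calc ∫⁻ x, ENNReal.ofReal (‖u t x‖ ^ θ)
        ≤ ∫⁻ x, ENNReal.ofReal (B₀ ^ (θ - 2)) * ‖u t x‖ₑ ^ 2 := lintegral_mono fun x => by
          rw [← ofReal_norm, ← ENNReal.ofReal_pow (norm_nonneg _),
            ← ENNReal.ofReal_mul (Real.rpow_nonneg hB₀0 _)]
          exact ENNReal.ofReal_le_ofReal (hptθ t ht x)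
      _ = ENNReal.ofReal (B₀ ^ (θ - 2)) * ∫⁻ x, ‖u t x‖ₑ ^ 2 :=
          lintegral_const_mul' _ _ ENNReal.ofReal_ne_top
      _ ≤ ENNReal.ofReal (B₀ ^ (θ - 2)) * C₀ := by gcongr; exact hzero (hC₀ t ht)
  -- the slice bound at a.e. interior time: `Φ t ≤ κ * Np t * G t`
  set Np : ℝ → ℝ := fun t =>
    (θ * Real.sqrt ((θ - 2) * CS *
        (∫ x, ‖gradient (p t) x‖ ^ ((θ + 2) / 3)) ^ (1 / ((θ + 2) / 3))) *
      (K ^ 2 * (θ ^ 2 / 4)) ^ (9 / (4 * (θ + 2)))) ^ (1 / Θ) with hNp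
  have hNp0 : ∀ t, 0 ≤ Np t := fun t => by positivity
  have hslice : ∀ t ∈ Ioo 0 T,
      eLpNorm (fun x => gradient (p t) x) (ENNReal.ofReal ((θ + 2) / 3)) volume < ⊤ →
      eLpNorm (p t) (ENNReal.ofReal ((θ + 2) / 2)) volume ≤
        CS * eLpNorm (u t) (ENNReal.ofReal (θ + 2)) volume ^ 2 →
      Φ t ≤ κ * Np t * G t := by
    intro t ht hLqt hRzt
    have htI : t ∈ Icc 0 T := Ioo_subset_Icc_self ht
    have hmom : ∀ x, W t x + FluidPDE.convect (u t) (u t) x = ν • (Δ (u t)) x - gradient (p t) x := by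
      intro x
      have h := hsol.momentum t htI x
      simpa [hW] using h
    have hsl := ltheta_slice_le_of_momentum hν
      ((hsol.contDiff_velocity htI).of_le (by norm_cast))
      ((hsol.contDiff_pressure htI).of_le (by norm_cast)) hmom (hsol.divFree t htI)
      (fun x => hB₀ t htI x)
      ((hzero (hC₀ t htI)).trans_lt ENNReal.coe_lt_top) ((hC₁ t htI).trans_lt ENNReal.coe_lt_top)
      ((hD₂ t htI).trans_lt ENNReal.coe_lt_top)
      (hzero' (hP₀ t htI)) ((hP₁ t htI).trans_lt ENNReal.coe_lt_top) hθ hLqt hRzt hΘ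
    refine hsl.trans_eq ?_
    simp only [hκ, hNp, hK, hG]
  -- Grönwall in `ℝ≥0∞`
  set φE : ℝ → ℝ≥0∞ := fun t => ENNReal.ofReal (G t) with hφE
  set aE : ℝ → ℝ≥0∞ := fun t => ENNReal.ofReal κ * ENNReal.ofReal (Np t) with haE
  have hM : ∀ t ∈ Icc 0 s, φE t ≤ ENNReal.ofReal (B₀ ^ (θ - 2)) * C₀ := fun t ht =>
    hGle t ⟨ht.1, ht.2.trans hs.2⟩
  have haS : ∫⁻ t in Ioo 0 s, aE t ≠ ⊤ := by
    rw [haE]; simp only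
    rw [lintegral_const_mul' _ _ ENNReal.ofReal_ne_top]
    exact ENNReal.mul_ne_top ENNReal.ofReal_ne_top hA
  have hcmp : ∀ᵐ τ ∂volume, τ ∈ Ioo 0 s → ENNReal.ofReal (Φ τ) ≤ aE τ * φE τ := by
    filter_upwards [hLq] with τ hτ hτs
    have hτT : τ ∈ Ioo 0 T := ⟨hτs.1, hτs.2.trans_le hs.2⟩
    obtain ⟨hLqt, hRzt⟩ := hτ hτs
    calc ENNReal.ofReal (Φ τ) ≤ ENNReal.ofReal (κ * Np τ * G τ) :=
          ENNReal.ofReal_le_ofReal (hslice τ hτT hLqt hRzt)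
      _ = aE τ * φE τ := by
          rw [haE, hφE]; simp only
          rw [ENNReal.ofReal_mul (mul_nonneg hκ0 (hNp0 τ)), ENNReal.ofReal_mul hκ0]
  have hineq : ∀ t ∈ Icc 0 s, φE t ≤ φE 0 + ∫⁻ τ in Ioo 0 t, aE τ * φE τ := by
    intro t ht
    rcases eq_or_lt_of_le ht.1 with h0 | ht0
    · rw [← h0]; simp
    have htT : t ∈ Ioc 0 T := ⟨ht0, ht.2.trans hs.2⟩
    have hΦt : IntegrableOn Φ (Ioo 0 t) volume := hΦint.mono_set (Ioo_subset_Ioo le_rfl htT.2)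
    have h1 : ENNReal.ofReal (∫ τ in Ioo 0 t, Φ τ) ≤ ∫⁻ τ in Ioo 0 t, ENNReal.ofReal (Φ τ) := by
      calc ENNReal.ofReal (∫ τ in Ioo 0 t, Φ τ) ≤ ENNReal.ofReal (∫ τ in Ioo 0 t, max (Φ τ) 0) :=
            ENNReal.ofReal_le_ofReal (integral_mono hΦt hΦt.pos_part fun τ => le_max_left _ _)
        _ = ∫⁻ τ in Ioo 0 t, ENNReal.ofReal (max (Φ τ) 0) :=
            ofReal_integral_eq_lintegral_ofReal hΦt.pos_part (Eventually.of_forall fun τ => le_max_right _ _)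
        _ = ∫⁻ τ in Ioo 0 t, ENNReal.ofReal (Φ τ) := lintegral_congr fun τ => by
            rcases le_total (Φ τ) 0 with h | h
            · rw [max_eq_right h, ENNReal.ofReal_zero, ENNReal.ofReal_of_nonpos h]
            · rw [max_eq_left h]
    have h2 : ∫⁻ τ in Ioo 0 t, ENNReal.ofReal (Φ τ) ≤ ∫⁻ τ in Ioo 0 t, aE τ * φE τ := by
      refine lintegral_mono_ae ((ae_restrict_iff' measurableSet_Ioo).2 ?_)
      filter_upwards [hcmp] with τ hτ hτt
      exact hτ ⟨hτt.1, hτt.2.trans_le ht.2⟩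
    calc φE t = ENNReal.ofReal (G 0 + ∫ τ in (0 : ℝ)..t, Φ τ) := by
          rw [hφE]; simp only; congr 1; exact hGb t htT
      _ ≤ ENNReal.ofReal (G 0) + ENNReal.ofReal (∫ τ in (0 : ℝ)..t, Φ τ) := ENNReal.ofReal_add_le
      _ = φE 0 + ENNReal.ofReal (∫ τ in Ioo 0 t, Φ τ) := by
          rw [intervalIntegral.integral_of_le ht.1, integral_Ioc_eq_integral_Ioo]
      _ ≤ φE 0 + ∫⁻ τ in Ioo 0 t, aE τ * φE τ := by gcongr; exact h1.trans h2
  have hgron := lintegral_gronwall_le (S := s) ENNReal.ofReal_ne_top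
    (ENNReal.mul_ne_top ENNReal.ofReal_ne_top ENNReal.coe_ne_top) hM haS hineq s ⟨hs.1.le, le_rfl⟩
  -- unpack
  have hint_a : (∫⁻ τ in Ioo 0 s, aE τ).toReal =
      κ * (∫⁻ t in Ioo 0 s, ENNReal.ofReal (Np t)).toReal := by
    rw [haE]; simp only
    rw [lintegral_const_mul' _ _ ENNReal.ofReal_ne_top, ENNReal.toReal_mul, ENNReal.toReal_ofReal hκ0]
  rw [hint_a] at hgron
  rw [← hGeq s ⟨hs.1.le, hs.2⟩, ← hGeq 0 ⟨le_rfl, hT.le⟩, mul_comm]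
  convert hgron using 3

end Gronwall

end Literature.Analysis.FluidPDE

end
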